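import Summits.QuantumAdvantage.QuantumAdvantage.Theorems.CharDialIslandDialC
import HarnessLib

/-!
# CharDialLevelDialA — TREE PART A of the decomp-qadv lens-5 g29 node «LevelDial» on `CharDial.FrobStructureLawOdd`
# (stmt-QuantumAdvantage-27205): the dial `RPrimeAt p K m` (R′(p) with budget `K` at level `m`), the pieces `BaseAt/BaseOdd` (finite range),
# `TailAt` (asymptotic regime), `GlueAt/GlueOdd` (lens-6's glue conjecture (G), typed), the slice lemmas, the block-weight lemmas and the
# UP-LEMMA `lift_swap`.  Verbatim from the node file (namespace `Theses.LevelDial → Theorems.LevelDial`), cut at `end Up` (≤ 400-line lint).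


Lens 5 «finite/base range + asymptotic regime + bridge», applied INSIDE piece E (`IslandDial.ExchCoreOdd`) of the g28 split
`FrobStructureLawOdd ↔ ExchCoreOdd ∧ IslandOdd` (tree: `Theorems.IslandDial.target_iff_pieces`).

THE DIAL.  Fix a prime `p` and a defect budget `K`.  `RPrimeAt p K m` (= lens-6's R′(p) at level `m`, typed ambiently): every Boolean
`f` depending only on an `m`-set `X` of coordinates, of `𝔽_p`-degree `≤ p − 1`, whose top Möbius layer on `X` is a NON-ZERO constant
`γ`, is pairwise exchangeable on all but `≤ K` coordinates of `X`.  The dial is the level `m`: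
* FINITE RANGE   = the single level `m = nB p K := 2K + 1 + max p (K + 1)` (a statement about the finitely many Boolean
  functions of `nB` variables) — piece `BaseOdd`;
* ASYMPTOTIC REGIME = all levels `m ≥ nB p K` (`TailAt`);
* BRIDGE (KERNEL, this file, uniform in `(p, K)`): `tail_of_base : RPrimeAt p K (nB p K) → ∀ m ≥ nB p K, RPrimeAt p K m` — slice
  induction on `|X|`: the two `x`-slices are exchangeable off `≤ K` (IH), their common core `R` (`|R| ≥ m − 2K ≥ p + 1`) is
  exchangeable for `f`, so `f = H(u|_{Rᶜ}, wt_R mod p)` (tree `exch_weight_form`); the ZERO SUB-SLICE of `f` on `J ∪ R'`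
  (`J = X ∖ R`, `R' ⊆ R`, `|J ∪ R'| = nB`) is again in the class, the BASE gives its exchangeable set `Y'`, and the UP-LEMMA
  `lift_swap` lifts every transposition `(j r₀)`, `j ∈ J ∩ Y'`, `r₀ ∈ R' ∩ Y'`, from the sub-slice to `f` through the weight
  form (re-balance the weight of `R` mod `p` inside `R' ∖ {r₀}`).  No tables, no degree dictionary, no census inside the proof.
* GLUE (piece `GlueOdd`, attackable) = lens-6's conjecture (G) typed for every budget: if every OUTSIDE slice of `f` over `X` is
  exchangeable off `≤ K` coordinates then `f` is exchangeable off `≤ E(p, K)` coordinates of `X` (PLAN-g9 §11.4 proves it on paper at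
  `p = 5`, `K = 1`, `E = 1285`, with the support lemma `SubLog.card_support_ge_of_mem_lowDeg`); asymptotic regime + glue ⟹ `ExchCoreAt p`.

PIECES (all typed BY NAME against the tree):  `closes : BaseOdd → GlueOdd → IslandDial.IslandOdd → CharDial.FrobStructureLawOdd`
and the split is EXACT: `target_iff_pieces : FrobStructureLawOdd ↔ BaseOdd ∧ GlueOdd ∧ IslandOdd`.
NUMBERS: `nB 5 1 = 8` is EXACTLY the census threshold of lens-6 CENSUS-I2 §D4 (R′(5) with K = 1 fails at 7 variables — 6 972 of the
7 142 functions need K ≥ 4 — and holds at 8: F₈ = 190 = 30 symmetric + 8·20 one-twists), so `BaseAt 5` is certified by that census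
(instrumentable, not kernel: 2^256 functions); `p = 7`: K₀(7) = 4 (census K41) gives the located finite residual `RPrimeAt 7 4 16`.
-/

set_option autoImplicit false
set_option linter.dupNamespace false

namespace Summit.QuantumAdvantage.QuantumAdvantage.Theorems.LevelDial

open Finset
open Summit.QuantumAdvantage.AdviceFreeQNC0
open Literature.Computability.MetaComplexity Literature.Computability.MetaComplexity.Smolensky
open Summit.QuantumAdvantage.QuantumAdvantage.Theorems.IslandDial (Exch TopConst ExchCoreAt ExchCoreOdd IslandAt IslandOdd
  exch_weight_form)

/-! ### The dial: R′(p, K) at level m -/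

/-- `RPrimeAt p K m` — R′(p) with defect budget `K` at level `m`: a Boolean function of the `m` coordinates `X` (Mathlib's
`DependsOn f ↑X`), of `𝔽_p`-degree `≤ p − 1`, with constant non-zero top Möbius layer on `X`, is pairwise exchangeable on a `Y ⊆ X`
with `|X ∖ Y| ≤ K`. -/
def RPrimeAt (p : ℕ) [Fact p.Prime] (K m : ℕ) : Prop :=
  ∀ (n : ℕ) (f : (Fin n → Bool) → Bool) (X : Finset (Fin n)), X.card = m → DependsOn f (↑X : Set (Fin n)) →
    HasDegF p f (p - 1) → (∃ γ : ZMod p, γ ≠ 0 ∧ TopConst p f X γ) →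
    ∃ Y : Finset (Fin n), Y ⊆ X ∧ m ≤ Y.card + K ∧ Exch f Y

/-- The threshold level of the bridge. -/
def nB (p K : ℕ) : ℕ := 2 * K + 1 + max p (K + 1)

/-- How far the finite range must reach at `p = 5` with the census budget `K₀(5) = 1`: level 8 — exactly the census threshold
(lens-6 CENSUS-I2 §D4: R′(5) with `K = 1` fails at 7 variables and holds at 8, F₈ = 190 = 30 + 8·20). -/
theorem nB_five_one : nB 5 1 = 8 := by decide

/-- … and at `p = 7` with the census budget `K₀(7) = 4` (census K41 A3): level 16 — the located finite residual `RPrimeAt 7 4 16`. -/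
theorem nB_seven_four : nB 7 4 = 16 := by decide

/-- FINITE RANGE at `p`: R′ holds at the single level `nB p K` for some budget `K`. -/
def BaseAt (p : ℕ) [Fact p.Prime] : Prop := ∃ K : ℕ, RPrimeAt p K (nB p K)

/-- Piece B, typed over the odd primes `p ≥ 5` of the target. -/
def BaseOdd : Prop := ∀ (p : ℕ) [Fact p.Prime], 5 ≤ p → BaseAt p

/-- ASYMPTOTIC REGIME at `p`: R′ holds at every level `≥ nB p K` for some budget `K`. -/
def TailAt (p : ℕ) [Fact p.Prime] : Prop := ∃ K : ℕ, ∀ m : ℕ, nB p K ≤ m → RPrimeAt p K m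

/-- GLUE at `p` — lens-6's conjecture (G) «glue across outside slices» (PLAN-g9 §10(iv)), typed for every budget `K`: if `f` has
`𝔽_p`-degree `≤ p − 1` and constant non-zero top layer on `X`, and EVERY outside slice `u ↦ f (merge X u σ)` is pairwise exchangeable on
all but `≤ K` coordinates of `X`, then `f` itself is pairwise exchangeable on all but `≤ E` coordinates of `X` (`E` depending on `p, K`
only).  Plain statement (no reference to the dial); with the asymptotic regime it gives `ExchCoreAt p` (`exchCoreAt_of_tail_glue`). -/
def GlueAt (p : ℕ) [Fact p.Prime] : Prop :=
  ∀ K : ℕ, ∃ E : ℕ, ∀ (n : ℕ) (f : (Fin n → Bool) → Bool) (X : Finset (Fin n)), HasDegF p f (p - 1) →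
    (∃ γ : ZMod p, γ ≠ 0 ∧ TopConst p f X γ) →
    (∀ σ : Fin n → Bool, ∃ Y : Finset (Fin n), Y ⊆ X ∧ X.card ≤ Y.card + K ∧ Exch (fun u => f (SubLog.merge X u σ)) Y) →
    ∃ Y : Finset (Fin n), Y ⊆ X ∧ X.card ≤ Y.card + E ∧ Exch f Y

/-- Piece G, typed over the odd primes `p ≥ 5` of the target. -/
def GlueOdd : Prop := ∀ (p : ℕ) [Fact p.Prime], 5 ≤ p → GlueAt p

/-! ### Slices keep the class -/

section Slices

variable {p : ℕ} [hp : Fact p.Prime] {n : ℕ}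

/-- A slice over `S` depends only on `S`. -/
theorem depOn_slice (f : (Fin n → Bool) → Bool) (S : Finset (Fin n)) (v : Fin n → Bool) :
    DependsOn (fun u => f (SubLog.merge S u v)) (↑S : Set (Fin n)) := by
  intro u w huw
  have h : SubLog.merge S u v = SubLog.merge S w v := by
    funext i
    unfold SubLog.merge
    by_cases hi : i ∈ S
    · rw [if_pos hi, if_pos hi, huw i (Finset.mem_coe.2 hi)]
    · rw [if_neg hi, if_neg hi]
  show f (SubLog.merge S u v) = f (SubLog.merge S w v)
  rw [h]

/-- Slicing does not raise the `𝔽_p`-degree (tree `SubLog.restr_mem_lowDeg`). -/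
theorem hasDegF_slice {f : (Fin n → Bool) → Bool} {d : ℕ} (hf : HasDegF p f d) (S : Finset (Fin n)) (v : Fin n → Bool) :
    HasDegF p (fun u => f (SubLog.merge S u v)) d := by
  rw [SubLog.hasDegF_iff_indR] at hf ⊢
  have hres : SubLog.indR (ZMod p) (fun u => f (SubLog.merge S u v)) = SubLog.restr S v (SubLog.indR (ZMod p) f) := rfl
  rw [hres]
  exact SubLog.restr_mem_lowDeg S v hf

/-- Slices over `S ⊇ X₁` keep the top layer on `X₁ ⊆ X` (tree `SubLog.moeb_restr_eq_of_card_eq`). -/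
theorem topConst_slice {f : (Fin n → Bool) → Bool} {X X₁ S : Finset (Fin n)} {γ : ZMod p} (hf : HasDegF p f (p - 1))
    (htop : TopConst p f X γ) (hS : X₁ ⊆ S) (hX : X₁ ⊆ X) (v : Fin n → Bool) :
    TopConst p (fun u => f (SubLog.merge S u v)) X₁ γ := by
  intro T hT hTc
  have hres : SubLog.indR (ZMod p) (fun u => f (SubLog.merge S u v)) = SubLog.restr S v (SubLog.indR (ZMod p) f) := rfl
  rw [hres, SubLog.moeb_restr_eq_of_card_eq ((SubLog.hasDegF_iff_indR p f (p - 1)).1 hf) (hT.trans hS) hTc v]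
  exact htop T (hT.trans hX) hTc

/-- A slice agrees with `f` at the points already frozen correctly off `S` (inside `X`). -/
theorem slice_eq_self {f : (Fin n → Bool) → Bool} {X S : Finset (Fin n)} (hdep : DependsOn f (↑X : Set (Fin n)))
    {w v : Fin n → Bool} (hw : ∀ i ∈ X, i ∉ S → w i = v i) : f (SubLog.merge S w v) = f w := by
  apply hdep
  intro i hi
  unfold SubLog.merge
  by_cases hiS : i ∈ S
  · rw [if_pos hiS]
  · rw [if_neg hiS, hw i (Finset.mem_coe.1 hi) hiS]

/-- Exchangeability is inherited by subsets. -/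
theorem exch_mono {f : (Fin n → Bool) → Bool} {Y R : Finset (Fin n)} (h : Exch f Y) (hR : R ⊆ Y) : Exch f R :=
  fun i hi j hj u => h i (hR hi) j (hR hj) u

/-- If both `x`-slices of `f` (a function of `X`) are exchangeable on `R ⊆ X ∖ {x}`, so is `f`. -/
theorem exch_of_two_slices {f : (Fin n → Bool) → Bool} {X R : Finset (Fin n)} {x : Fin n}
    (hdep : DependsOn f (↑X : Set (Fin n))) (hR : R ⊆ X.erase x) (h : ∀ b : Bool, Exch (fun u => f (SubLog.merge (X.erase x) u (fun _ => b))) R) : Exch f R := by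
  intro i hi j hj u
  have hxi : x ≠ i := by
    rintro rfl
    exact (Finset.mem_erase.1 (hR hi)).1 rfl
  have hxj : x ≠ j := by
    rintro rfl
    exact (Finset.mem_erase.1 (hR hj)).1 rfl
  have key : ∀ w : Fin n → Bool, f w = f (SubLog.merge (X.erase x) w (fun _ => w x)) := by
    intro w
    refine (slice_eq_self hdep fun i hi hiS => ?_).symm
    have hix : i = x := by
      by_contra hix
      exact hiS (Finset.mem_erase.2 ⟨hix, hi⟩)
    rw [hix]
  have hswx : (u ∘ Equiv.swap i j) x = u x := by
    show u (Equiv.swap i j x) = u x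
    rw [Equiv.swap_apply_of_ne_of_ne hxi hxj]
  rw [key (u ∘ Equiv.swap i j), key u, hswx]
  exact h (u x) i hi j hj u

end Slices

/-! ### Block weights: splitting off one coordinate, and a transposition with one leg outside the block -/

section Weights

variable {p : ℕ} {n : ℕ}

/-- `wt_R(w) = [w r] + wt_{R ∖ r}(w)` (cast to any `AddCommMonoidWithOne`). -/
theorem natCast_bw_erase (M : Type*) [AddCommMonoidWithOne M] {R : Finset (Fin n)} {r : Fin n} (hr : r ∈ R)
    (w : Fin n → Bool) : (SubChar.bw R w : M) = (if w r then (1 : M) else 0) + (SubChar.bw (R.erase r) w : M) := by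
  classical
  rw [SubChar.natCast_bw, SubChar.natCast_bw, Finset.add_sum_erase R (fun i => if w i then (1 : M) else 0) hr]

/-- For `r ∈ R`, `j ∉ R`: `wt_R(w ∘ (j r)) = [w j] + wt_{R ∖ r}(w)`. -/
theorem natCast_bw_swap_out (M : Type*) [AddCommMonoidWithOne M] {R : Finset (Fin n)} {r j : Fin n} (hr : r ∈ R)
    (hj : j ∉ R) (w : Fin n → Bool) :
    (SubChar.bw R (w ∘ Equiv.swap j r) : M) = (if w j then (1 : M) else 0) + (SubChar.bw (R.erase r) w : M) := by
  rw [natCast_bw_erase M hr]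
  have h1 : (w ∘ Equiv.swap j r) r = w j := by
    show w (Equiv.swap j r r) = w j
    rw [Equiv.swap_apply_right]
  have h2 : SubChar.bw (R.erase r) (w ∘ Equiv.swap j r) = SubChar.bw (R.erase r) w := by
    refine SubChar.bw_congr fun k hk => ?_
    have hkr : k ≠ r := (Finset.mem_erase.1 hk).1
    have hkj : k ≠ j := fun e => hj (e ▸ (Finset.mem_erase.1 hk).2)
    show w (Equiv.swap j r k) = w k
    rw [Equiv.swap_apply_of_ne_of_ne hkj hkr]
  rw [h1, h2]

/-- Agreement off `R` gives equal projections onto `Rᶜ`. -/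
theorem proj_congr_out {R : Finset (Fin n)} {w w' : Fin n → Bool} (h : ∀ k, k ∉ R → w k = w' k) :
    JLin.proj (Finset.univ \ R) w = JLin.proj (Finset.univ \ R) w' := by
  funext k
  unfold JLin.proj
  by_cases hk : k ∈ Finset.univ \ R
  · rw [if_pos hk, if_pos hk, h k (Finset.mem_sdiff.1 hk).2]
  · rw [if_neg hk, if_neg hk]

end Weights

/-! ### The UP-lemma: lifting a transposition from the zero sub-slice to `f` through the weight form -/

section Up

variable {p : ℕ} [hp : Fact p.Prime] {n : ℕ}

/-- **UP-LEMMA.**  `f = H(u|_{Rᶜ}, wt_R mod p)`, `R' ⊆ R` with `|R'| ≥ p`, `r₀ ∈ R'`, `j ∉ R`; `g` is `f` with the coordinates of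
`R ∖ R'` frozen to `false` (abstractly: `hS`).  If `g` is invariant under the transposition `(j r₀)`, so is `f`. -/
theorem lift_swap {f g : (Fin n → Bool) → Bool} {R R' : Finset (Fin n)} {H : (Fin n → Bool) → ZMod p → Bool} {r₀ j : Fin n}
    (hH : ∀ u, f u = H (JLin.proj (Finset.univ \ R) u) (SubChar.bw R u : ZMod p))
    (hR'R : R' ⊆ R) (hpR' : p ≤ R'.card) (hr₀ : r₀ ∈ R') (hjR : j ∉ R)
    (hS : ∀ w : Fin n → Bool, (∀ z ∈ R, z ∉ R' → w z = false) → g w = f w)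
    (hex : ∀ u, g (u ∘ Equiv.swap j r₀) = g u) :
    ∀ u, f (u ∘ Equiv.swap j r₀) = f u := by
  classical
  intro u
  have hr₀R : r₀ ∈ R := hR'R hr₀
  -- re-balance the weight of `R ∖ r₀` mod `p` inside `R' ∖ r₀`
  obtain ⟨C, hCsub, hCcard⟩ : ∃ C ⊆ R'.erase r₀, C.card = SubChar.bw (R.erase r₀) u % p := by
    apply Finset.exists_subset_card_eq
    have h1 : (R'.erase r₀).card = R'.card - 1 := Finset.card_erase_of_mem hr₀
    have h2 : SubChar.bw (R.erase r₀) u % p < p := Nat.mod_lt _ hp.out.pos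
    omega
  set us : Fin n → Bool := fun k => if k ∈ R then (if k = r₀ then u r₀ else decide (k ∈ C)) else u k with hus
  have hus_out : ∀ k, k ∉ R → us k = u k := fun k hk => by simp [hus, hk]
  have hus_r₀ : us r₀ = u r₀ := by simp [hus, hr₀R]
  have hus_Z : ∀ z ∈ R, z ∉ R' → us z = false := by
    intro z hz hz'
    have hz0 : z ≠ r₀ := fun e => hz' (e ▸ hr₀)
    have hzC : z ∉ C := fun h => hz' (Finset.mem_of_mem_erase (hCsub h))
    simp [hus, hz, hz0, hzC]
  have hbw_us : SubChar.bw (R.erase r₀) us = C.card := by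
    unfold SubChar.bw
    congr 1
    ext k
    rw [Finset.mem_filter, Finset.mem_erase]
    constructor
    · rintro ⟨⟨hk0, hkR⟩, hk⟩
      simpa [hus, hkR, hk0] using hk
    · intro hkC
      have hk' : k ∈ R'.erase r₀ := hCsub hkC
      have hk0 : k ≠ r₀ := (Finset.mem_erase.1 hk').1
      have hkR : k ∈ R := hR'R (Finset.mem_erase.1 hk').2
      exact ⟨⟨hk0, hkR⟩, by simp [hus, hkR, hk0, hkC]⟩
  have hmod : (SubChar.bw (R.erase r₀) us : ZMod p) = (SubChar.bw (R.erase r₀) u : ZMod p) := by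
    rw [hbw_us, hCcard, ZMod.natCast_mod]
  have hw1 : (SubChar.bw R us : ZMod p) = (SubChar.bw R u : ZMod p) := by
    rw [natCast_bw_erase (ZMod p) hr₀R, natCast_bw_erase (ZMod p) hr₀R, hmod, hus_r₀]
  have hw2 : (SubChar.bw R (us ∘ Equiv.swap j r₀) : ZMod p) = (SubChar.bw R (u ∘ Equiv.swap j r₀) : ZMod p) := by
    rw [natCast_bw_swap_out (ZMod p) hr₀R hjR, natCast_bw_swap_out (ZMod p) hr₀R hjR, hmod, hus_out j hjR]
  have hproj1 : JLin.proj (Finset.univ \ R) us = JLin.proj (Finset.univ \ R) u := proj_congr_out hus_out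
  have hproj2 : JLin.proj (Finset.univ \ R) (us ∘ Equiv.swap j r₀) = JLin.proj (Finset.univ \ R) (u ∘ Equiv.swap j r₀) := by
    refine proj_congr_out fun k hk => ?_
    by_cases hkj : k = j
    · subst hkj
      show us (Equiv.swap k r₀ k) = u (Equiv.swap k r₀ k)
      rw [Equiv.swap_apply_left, hus_r₀]
    · have hkr : k ≠ r₀ := fun e => hk (e ▸ hr₀R)
      show us (Equiv.swap j r₀ k) = u (Equiv.swap j r₀ k)
      rw [Equiv.swap_apply_of_ne_of_ne hkj hkr, hus_out k hk]
  have hZsw : ∀ z ∈ R, z ∉ R' → (us ∘ Equiv.swap j r₀) z = false := by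
    intro z hz hz'
    have hzj : z ≠ j := fun e => hjR (e ▸ hz)
    have hzr : z ≠ r₀ := fun e => hz' (e ▸ hr₀)
    show us (Equiv.swap j r₀ z) = false
    rw [Equiv.swap_apply_of_ne_of_ne hzj hzr]
    exact hus_Z z hz hz'
  calc f (u ∘ Equiv.swap j r₀) = f (us ∘ Equiv.swap j r₀) := by
        rw [hH (u ∘ Equiv.swap j r₀), hH (us ∘ Equiv.swap j r₀), hproj2, hw2]
    _ = g (us ∘ Equiv.swap j r₀) := (hS _ hZsw).symm
    _ = g us := hex us
    _ = f us := hS us hus_Z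
    _ = f u := by rw [hH us, hH u, hproj1, hw1]

end Up

end Summit.QuantumAdvantage.QuantumAdvantage.Theorems.LevelDial
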